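import Summits.ABC.ABC.Theses.IneffectiveSubspace
import Summits.ABC.ABC.Theses.NegOmegaAtlas
import Summits.ABC.ABC.Theorems.IneffectiveSubspaceUniformSadicTowerFourHeavyGivesBoundedOmega
import Summits.ABC.ABC.Theorems.IneffectiveSubspaceUniformSadicTowerFourStubOmegaCountedTwo
import Literature.NumberTheory.DiophantineGeometry.AbcWave0QualityFormProofs

/-!
# Strategist workfile (seat `planner-cstrat-stmt-ABC-14937-s1-0`, 2026-08-17) for the crux
# `UniformSadicTowerFour` (stmt-ABC-14937, route `IneffectiveSubspace`, rank 2)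

Companion of `Cruxes/UniformSadicTowerFour/STRATEGY-CENSUS.md` (section "generation s1").  Everything
here is sorry-free and is a COMPOSITION of theorems already landed in `Theorems/` by the line leads c1/c2
and by the `DeepRegimeABC` chain; nothing is registered as a line or a stub, and the live skeleton v4
(`stub_heavyCore`, `stub_deepRegimeABC`, lead c2) is untouched.  What the file settles by name:

* §1 THE NORMAL FORM OF THE CRUX MODULO THE ROUTE'S OTHER LOAD-BEARING CRUX #6 (`DeepRegimeABC`):
  `UniformSadicTowerFour → BoundedOmegaABC` outright (`boundedOmega_of_uniformSadicTowerFour`) and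
  `BoundedOmegaABC → DeepRegimeABC → UniformSadicTowerFour` (through `ABC`), hence
  `uniformSadicTowerFour_iff_boundedOmega (h₆ : DeepRegimeABC)`.  `BoundedOmegaABC` := abc with a
  constant `C(W, ε)` on every cell `{ω(abc) ≤ W}` — the S-unit / Pillai corner with moving primes; no
  level 4, no `S`, no `θ` survives.  (Lead c2 registered the same reading as stubs
  `uniformSadicTowerFour_iff_boundedOmega_of_deepRegimeABC`, `boundedOmega_iff_uniformSUnit`, 03:12Z;
  this file re-derives the first by name so the census can cite a checked statement.)
* §2 CROSS-ROUTE IDENTIFICATION: in its finiteness form, `BoundedOmegaABC` is LITERALLY the negation of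
  the target `NegThesis` of the negative-side route `NegOmegaAtlas` (stmt-ABC-1224):
  `boundedOmegaABC_iff_not_negThesis`.  Consequences by name: `not_negThesis_of_uniformSadicTowerFour`
  (a proof of this crux REFUTES route NegOmegaAtlas's target), `uniformSadicTowerFour_iff_not_negThesis
  (h₆)`, and the kill paths `not_uniformSadicTowerFour_of_threeSlotFamily / _of_unbalancedFamily /
  _of_balancedFamily / _of_negThesis` — a proof of ANY cell crux of NegOmegaAtlas (stmt-ABC-1225/1226/
  1227) refutes this crux (and `ABC`).  So the typed ENEMY LIST of #2-modulo-#6 is the bounded-ω atlas,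
  not level-4 families.
* §3 THE ω-LADDER: `BoundedOmegaABC ↔ ∀ W, BoundedOmegaAt W`, monotone in `W`; `W ≤ 2` is a THEOREM
  (`boundedOmegaAt_two` = the landed `MixedRadical.stub_omegaCounted_two`, p97349); the first open rung
  is `W = 3` and `boundedOmegaAt_three_iff_not_threeSlotFamily` identifies it with `¬ThreeSlotFamily`
  (item stmt-ABC-1227 of NegOmegaAtlas: uniform prime-base Fermat–Catalan / varying-base Pillai).
* §4 THE EXPONENT-REGIME CUT of `BoundedOmegaABC` (census §Decomposition D-s1-3): POLY (∃ A(W):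
  `c < C·rad^A` on `{ω ≤ W}` — "polynomial abc on bounded-ω cells", the natural target of
  linear-forms-in-logarithms technology) ∧ LOW (abc(1+ε) on `{ω ≤ W, c < C'·rad^A}` for every `A`) →
  `BoundedOmegaABC`, with both pieces below `BoundedOmegaABC` (`poly_of_boundedOmega`,
  `low_of_boundedOmega`).  Typed to make the census's "no engine on either piece" statement precise; NOT
  filed (Rule-N: a bare regime split with two plan-less abc/Baker-class pieces).
-/

-- `Summit.<Summit>.<Problem>` is the mandated summit-side namespace (CONVENTIONS §2); for the
-- single-conjunct summit `ABC` the two coincide, so the duplicate `ABC.ABC` is deliberate.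
set_option linter.dupNamespace false

noncomputable section

namespace Summit.ABC.ABC.Cruxes.UniformSadicTowerFour.StrategistS1

open Literature.NumberTheory.DiophantineGeometry (IsABCTriple rad quality)
open Summit.ABC.ABC.Theses.IneffectiveSubspace (UniformSadicTowerFour DeepRegimeABC AbcGivesUniformSadic)
open Summit.ABC.ABC.Theses.NegOmegaAtlas (NegThesis ThreeSlotFamily UnbalancedFamily BalancedFamily)
open Summit.ABC.ABC.Theorems (abcGivesUniformSadic_proof)
open Summit.ABC.ABC.Theorems.UniformSadicTowerFour.HeavyPlaces (boundedOmega_of_heavyCore)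
open Summit.ABC.ABC.Theorems.UniformSadicTowerFour.FlatSteepSplit
  (uniformSadicTowerFour_iff_quarter_and_core heavyCore_of_abc)
open Summit.ABC.ABC.Theorems.UniformSadicTowerFour.MixedRadical (stub_omegaCounted_two)
open Summit.ABC.ABC.Theorems.DeepRegimeABC (abc_of_deepRegimeABC_of_boundedOmega deepRegimeABC_of_abc)

/-! ## Vocabulary -/

/-- abc with a constant `C(W, ε)` on the cell `{ω(abc) ≤ W}` (constant form). [folklore] -/
def BoundedOmegaAt (W : ℕ) : Prop :=
  ∀ ε : ℝ, 0 < ε → ∃ C : ℝ, 0 < C ∧ ∀ a b c : ℕ, IsABCTriple a b c →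
    (a * b * c).primeFactors.card ≤ W → (c : ℝ) < C * ((rad a b c : ℕ) : ℝ) ^ (1 + ε)

/-- `BoundedOmegaABC`: abc on EVERY bounded-ω cell, constant per cell — the corner that, with crux #6
`DeepRegimeABC`, is `ABC` (`DeepRegimeABC.abc_iff_deepRegimeABC_and_boundedOmega`). [folklore] -/
def BoundedOmegaABC : Prop := ∀ W : ℕ, BoundedOmegaAt W

/-- Unfolding: `BoundedOmegaABC` is verbatim the hypothesis `hcorner` of
`DeepRegimeABC.abc_of_deepRegimeABC_of_boundedOmega`. [folklore] -/
theorem boundedOmegaABC_iff :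
    BoundedOmegaABC ↔ ∀ W : ℕ, ∀ ε : ℝ, 0 < ε → ∃ C : ℝ, 0 < C ∧ ∀ a b c : ℕ, IsABCTriple a b c →
      (a * b * c).primeFactors.card ≤ W → (c : ℝ) < C * ((rad a b c : ℕ) : ℝ) ^ (1 + ε) :=
  Iff.rfl

/-! ## §1 The normal form of the crux modulo crux #6 -/

/-- **The crux gives `BoundedOmegaABC` outright** (no #6 needed): crux ⟹ HEAVY-CORE
(`uniformSadicTowerFour_iff_quarter_and_core`, p138240) ⟹ abc on bounded-ω cells
(`boundedOmega_of_heavyCore`, p139963). [folklore] -/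
theorem boundedOmega_of_uniformSadicTowerFour (h : UniformSadicTowerFour) : BoundedOmegaABC :=
  fun W => boundedOmega_of_heavyCore (uniformSadicTowerFour_iff_quarter_and_core.mp h).2 W

/-- **`BoundedOmegaABC ∧ DeepRegimeABC ⟹ ABC`** (the landed ω-complement theorem, re-read). [folklore] -/
theorem abc_of_boundedOmega_of_deepRegimeABC (hB : BoundedOmegaABC) (h₆ : DeepRegimeABC) : ABC :=
  abc_of_deepRegimeABC_of_boundedOmega h₆ hB

/-- **`BoundedOmegaABC ∧ DeepRegimeABC ⟹ crux`** (through `ABC` and the landed upper sandwich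
`abcGivesUniformSadic_proof`). [folklore] -/
theorem uniformSadicTowerFour_of_boundedOmega_of_deepRegimeABC (hB : BoundedOmegaABC)
    (h₆ : DeepRegimeABC) : UniformSadicTowerFour :=
  (show ABC → UniformSadicTowerFour from abcGivesUniformSadic_proof)
    (abc_of_boundedOmega_of_deepRegimeABC hB h₆)

/-- **NORMAL FORM: modulo crux #6, the crux IS `BoundedOmegaABC`.**  Given `DeepRegimeABC` (the
route's other load-bearing binder of `closes`), `UniformSadicTowerFour ↔ BoundedOmegaABC`: the level-4
rounding, the place set `S`, the budget `K` and the heaviness dial `θ` all drop out. [folklore] -/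
theorem uniformSadicTowerFour_iff_boundedOmega (h₆ : DeepRegimeABC) :
    UniformSadicTowerFour ↔ BoundedOmegaABC :=
  ⟨boundedOmega_of_uniformSadicTowerFour, fun hB => uniformSadicTowerFour_of_boundedOmega_of_deepRegimeABC hB h₆⟩

/-- `ABC ↔ BoundedOmegaABC ∧ DeepRegimeABC` (the route's load-bearing pair in minimal form). [folklore] -/
theorem abc_iff_boundedOmega_and_deepRegimeABC : ABC ↔ BoundedOmegaABC ∧ DeepRegimeABC :=
  ⟨fun h => ⟨boundedOmega_of_uniformSadicTowerFour
      ((show ABC → UniformSadicTowerFour from abcGivesUniformSadic_proof) h), deepRegimeABC_of_abc h⟩,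
    fun h => abc_of_boundedOmega_of_deepRegimeABC h.1 h.2⟩

/-! ## §2 Finiteness form and the cross-route identification with `¬NegThesis` -/

/-- Level-`W`, margin-`δ` violators: abc triples with `ω(abc) ≤ W` and quality `> 1 + δ` — verbatim the
set whose infinitude `NegOmegaAtlas.NegThesis` asserts. [folklore] -/
def Violators (W : ℕ) (δ : ℝ) : Set (ℕ × ℕ × ℕ) :=
  {t | IsABCTriple t.1 t.2.1 t.2.2 ∧ (t.1 * t.2.1 * t.2.2).primeFactors.card ≤ W ∧
    1 + δ < quality t.1 t.2.1 t.2.2}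

/-- `NegThesis` re-read through `Violators`. [folklore] -/
theorem negThesis_iff : NegThesis ↔ ∃ W : ℕ, ∃ δ : ℝ, 0 < δ ∧ (Violators W δ).Infinite :=
  Iff.rfl

/-- **Constant form ⟹ finiteness form on a cell**: with `C = C(δ/2)`, a level-`W` violator of margin
`δ` has `rad^(δ/2) < C`, hence bounded radical and bounded `c`. (Bombieri–Gubler Rem. 12.4.15, per
cell.) [cite: BombieriGubler2006, Rem. 12.4.15] -/
theorem finite_violators_of_boundedOmegaAt {W : ℕ} (H : BoundedOmegaAt W) :
    ∀ δ : ℝ, 0 < δ → (Violators W δ).Finite := by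
  intro δ hδ
  obtain ⟨C, hC, hCabc⟩ := H (δ / 2) (half_pos hδ)
  set R : ℕ := ⌈C ^ (2 / δ)⌉₊ with hR
  set N : ℕ := ⌈C * (R : ℝ) ^ (1 + δ / 2)⌉₊ with hN
  refine ((Set.finite_Iic N).prod ((Set.finite_Iic N).prod (Set.finite_Iic N))).subset ?_
  rintro ⟨a, b, c⟩ hmem
  obtain ⟨ht, hω, hq⟩ : IsABCTriple a b c ∧ (a * b * c).primeFactors.card ≤ W ∧
      1 + δ < quality a b c := hmem
  have hlt : (c : ℝ) < C * (rad a b c : ℝ) ^ (1 + δ / 2) := hCabc a b c ht hω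
  rw [ht.one_add_lt_quality_iff] at hq
  have hr1 : (1 : ℝ) < (rad a b c : ℝ) := by exact_mod_cast ht.two_le_rad
  have hr0 : (0 : ℝ) < (rad a b c : ℝ) := zero_lt_one.trans hr1
  have hpos : (0 : ℝ) < (rad a b c : ℝ) ^ (1 + δ / 2) := Real.rpow_pos_of_pos hr0 _
  -- `rad^(δ/2) < C`
  have h1 : (rad a b c : ℝ) ^ (δ / 2) < C := by
    have hsplit : (rad a b c : ℝ) ^ (1 + δ) =
        (rad a b c : ℝ) ^ (1 + δ / 2) * (rad a b c : ℝ) ^ (δ / 2) := by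
      rw [← Real.rpow_add hr0]
      congr 1
      ring
    have h := hq.trans hlt
    rw [hsplit, mul_comm C] at h
    exact lt_of_mul_lt_mul_left h hpos.le
  -- `rad < C^(2/δ)`, hence `rad ≤ R`
  have h2 : (rad a b c : ℝ) ≤ R := by
    have h := Real.rpow_lt_rpow (Real.rpow_pos_of_pos hr0 _).le h1 (show (0 : ℝ) < 2 / δ by positivity)
    rw [← Real.rpow_mul hr0.le, show δ / 2 * (2 / δ) = 1 by field_simp, Real.rpow_one] at h
    exact h.le.trans (Nat.le_ceil _)
  -- `c < C · R^(1+δ/2)`, hence `c ≤ N`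
  have h3 : (c : ℝ) ≤ N := by
    have hRpow : (rad a b c : ℝ) ^ (1 + δ / 2) ≤ (R : ℝ) ^ (1 + δ / 2) :=
      Real.rpow_le_rpow hr0.le h2 (by positivity)
    have h : (c : ℝ) < C * (R : ℝ) ^ (1 + δ / 2) :=
      hlt.trans_le (mul_le_mul_of_nonneg_left hRpow hC.le)
    exact h.le.trans (Nat.le_ceil _)
  have hcN : c ≤ N := by exact_mod_cast h3
  obtain ⟨ha, hb, habc, -⟩ := ht
  simp only [Set.mem_prod, Set.mem_Iic]
  omega

/-- **Finiteness form ⟹ constant form on a cell**: the finitely many level-`W` violators of margin `ε`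
have `c ≤ N`; every other triple of the cell has `c ≤ rad^(1+ε)`; `C = N + 2` serves. [cite: BombieriGubler2006, Rem. 12.4.15] -/
theorem boundedOmegaAt_of_finite_violators {W : ℕ} (H : ∀ δ : ℝ, 0 < δ → (Violators W δ).Finite) :
    BoundedOmegaAt W := by
  intro ε hε
  have hfin := H ε hε
  obtain ⟨N, hN⟩ : ∃ N : ℕ, ∀ t ∈ Violators W ε, t.2.2 ≤ N := by
    obtain ⟨N, hN⟩ := (hfin.image fun t => t.2.2).bddAbove
    exact ⟨N, fun t ht => hN (Set.mem_image_of_mem _ ht)⟩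
  refine ⟨(N : ℝ) + 2, by positivity, fun a b c ht hω => ?_⟩
  have hN0 : (0 : ℝ) ≤ N := N.cast_nonneg
  have hr1 : (1 : ℝ) ≤ (rad a b c : ℝ) := by
    exact_mod_cast le_trans (by norm_num) ht.two_le_rad
  have hpow1 : (1 : ℝ) ≤ (rad a b c : ℝ) ^ (1 + ε) := Real.one_le_rpow hr1 (by positivity)
  by_cases hq : 1 + ε < quality a b c
  · have hc : c ≤ N := hN (a, b, c) ⟨ht, hω, hq⟩
    have hc' : (c : ℝ) ≤ N := by exact_mod_cast hc
    calc (c : ℝ) ≤ N := hc'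
      _ < (N : ℝ) + 2 := by linarith
      _ = ((N : ℝ) + 2) * 1 := (mul_one _).symm
      _ ≤ ((N : ℝ) + 2) * (rad a b c : ℝ) ^ (1 + ε) :=
        mul_le_mul_of_nonneg_left hpow1 (by positivity)
  · rw [ht.one_add_lt_quality_iff, not_lt] at hq
    calc (c : ℝ) ≤ (rad a b c : ℝ) ^ (1 + ε) := hq
      _ = 1 * (rad a b c : ℝ) ^ (1 + ε) := (one_mul _).symm
      _ < ((N : ℝ) + 2) * (rad a b c : ℝ) ^ (1 + ε) :=
        mul_lt_mul_of_pos_right (by linarith) (zero_lt_one.trans_le hpow1)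

/-- A cell of `BoundedOmegaABC` in its two forms. [cite: BombieriGubler2006, Rem. 12.4.15] -/
theorem boundedOmegaAt_iff_finite_violators (W : ℕ) :
    BoundedOmegaAt W ↔ ∀ δ : ℝ, 0 < δ → (Violators W δ).Finite :=
  ⟨finite_violators_of_boundedOmegaAt, boundedOmegaAt_of_finite_violators⟩

/-- **`BoundedOmegaABC` IS `¬NegThesis`** — the positive content of crux #2 modulo #6 and the target
of the negative-side route `NegOmegaAtlas` (stmt-ABC-1224) are negations of each other. [folklore] -/
theorem boundedOmegaABC_iff_not_negThesis : BoundedOmegaABC ↔ ¬ NegThesis := by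
  simp only [BoundedOmegaABC, boundedOmegaAt_iff_finite_violators, negThesis_iff, not_exists, not_and,
    Set.not_infinite]

/-- **A proof of the crux refutes route NegOmegaAtlas's target** (no #6 needed). [folklore] -/
theorem not_negThesis_of_uniformSadicTowerFour (h : UniformSadicTowerFour) : ¬ NegThesis :=
  boundedOmegaABC_iff_not_negThesis.mp (boundedOmega_of_uniformSadicTowerFour h)

/-- Contrapositive: `NegThesis` refutes the crux — a first-class kill path of stmt-ABC-14937 through an
EXISTING item (stmt-ABC-1224). [folklore] -/
theorem not_uniformSadicTowerFour_of_negThesis (h : NegThesis) : ¬ UniformSadicTowerFour :=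
  fun hU => not_negThesis_of_uniformSadicTowerFour hU h

/-- **Modulo #6 the crux is EXACTLY the negation of `NegThesis`.** [folklore] -/
theorem uniformSadicTowerFour_iff_not_negThesis (h₆ : DeepRegimeABC) :
    UniformSadicTowerFour ↔ ¬ NegThesis :=
  (uniformSadicTowerFour_iff_boundedOmega h₆).trans boundedOmegaABC_iff_not_negThesis

/-- The three atlas cells each imply `NegThesis` (drop the extra clause; `ThreeSlotFamily` is level 3).
[folklore] -/
theorem negThesis_of_threeSlotFamily (h : ThreeSlotFamily) : NegThesis := by
  obtain ⟨δ, hδ, hinf⟩ := h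
  exact ⟨3, δ, hδ, hinf⟩

/-- Cell (II-U) implies `NegThesis`. [folklore] -/
theorem negThesis_of_unbalancedFamily (h : UnbalancedFamily) : NegThesis := by
  obtain ⟨k, η, _hη, δ, hδ, hinf⟩ := h
  refine ⟨k, δ, hδ, hinf.mono ?_⟩
  rintro ⟨a, b, c⟩ ⟨ht, hω, _hbal, hq⟩
  exact ⟨ht, hω, hq⟩

/-- Cell (II-B) implies `NegThesis` (instantiate the balance clause at `η = 1` and drop it). [folklore] -/
theorem negThesis_of_balancedFamily (h : BalancedFamily) : NegThesis := by
  obtain ⟨k, δ, hδ, hall⟩ := h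
  refine ⟨k, δ, hδ, (hall 1 one_pos).mono ?_⟩
  rintro ⟨a, b, c⟩ ⟨ht, hω, _hbal, hq⟩
  exact ⟨ht, hω, hq⟩

/-- **Kill path**: a proof of NegOmegaAtlas's first open rung `ThreeSlotFamily` (stmt-ABC-1227) refutes
this crux. [folklore] -/
theorem not_uniformSadicTowerFour_of_threeSlotFamily (h : ThreeSlotFamily) : ¬ UniformSadicTowerFour :=
  not_uniformSadicTowerFour_of_negThesis (negThesis_of_threeSlotFamily h)

/-- **Kill path**: `UnbalancedFamily` (stmt-ABC-1225) refutes this crux. [folklore] -/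
theorem not_uniformSadicTowerFour_of_unbalancedFamily (h : UnbalancedFamily) : ¬ UniformSadicTowerFour :=
  not_uniformSadicTowerFour_of_negThesis (negThesis_of_unbalancedFamily h)

/-- **Kill path**: `BalancedFamily` (stmt-ABC-1226) refutes this crux. [folklore] -/
theorem not_uniformSadicTowerFour_of_balancedFamily (h : BalancedFamily) : ¬ UniformSadicTowerFour :=
  not_uniformSadicTowerFour_of_negThesis (negThesis_of_balancedFamily h)

/-! ## §3 The ω-ladder: `W ≤ 2` is a theorem, the first open rung is `W = 3 = ¬ThreeSlotFamily` -/

/-- The ladder is monotone: a larger cell's statement gives the smaller cell's. [folklore] -/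
theorem boundedOmegaAt_mono {W W' : ℕ} (hWW' : W ≤ W') (h : BoundedOmegaAt W') : BoundedOmegaAt W := by
  intro ε hε
  obtain ⟨C, hC, hCabc⟩ := h ε hε
  exact ⟨C, hC, fun a b c ht hω => hCabc a b c ht (hω.trans hWW')⟩

/-- **Rung 2 is closed** (landed `MixedRadical.stub_omegaCounted_two`, p97349: the cell is
`{1+1=2, (1, q, 2^j), (1, 2^i, q), (1, 8, 9)}`, `c < 2·rad`). [folklore] -/
theorem boundedOmegaAt_two : BoundedOmegaAt 2 := stub_omegaCounted_two

/-- Rungs `0, 1, 2` are closed. [folklore] -/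
theorem boundedOmegaAt_of_le_two {W : ℕ} (hW : W ≤ 2) : BoundedOmegaAt W :=
  boundedOmegaAt_mono hW boundedOmegaAt_two

/-- **The first open rung is NegOmegaAtlas's `ThreeSlotFamily`, negated**: `BoundedOmegaAt 3 ↔
¬ThreeSlotFamily` (uniform abc for `{1, p^x q^y, r^z}`-type and three-prime-power `p^x + q^y = r^z`
triples). [folklore] -/
theorem boundedOmegaAt_three_iff_not_threeSlotFamily : BoundedOmegaAt 3 ↔ ¬ ThreeSlotFamily := by
  rw [boundedOmegaAt_iff_finite_violators]
  simp only [ThreeSlotFamily, Violators, not_exists, not_and, Set.not_infinite]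

/-- Hence, modulo #6, refuting `ThreeSlotFamily` is exactly proving rung 3 of the crux's normal form,
and the crux needs every rung: `UniformSadicTowerFour → ¬ThreeSlotFamily`. [folklore] -/
theorem not_threeSlotFamily_of_uniformSadicTowerFour (h : UniformSadicTowerFour) : ¬ ThreeSlotFamily :=
  boundedOmegaAt_three_iff_not_threeSlotFamily.mp (boundedOmega_of_uniformSadicTowerFour h 3)

/-! ## §4 The exponent-regime cut of `BoundedOmegaABC` (typed; not filed) -/

/-- POLY: polynomial abc on bounded-ω cells — for every `W` some exponent `A(W)` and constant work:
`c < C·rad(abc)^A` whenever `ω(abc) ≤ W`.  The natural output SHAPE of linear forms in logarithms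
with the factor `p` removed from the `p`-adic estimates (unconditionally only
`log c ≪_W min(P(abc), rad^{1/3})·polylog` is known; quasi-polynomial in the unbalanced cell).
[folklore] -/
def PolyBoundedOmega : Prop :=
  ∀ W : ℕ, ∃ A C : ℝ, 0 < C ∧ ∀ a b c : ℕ, IsABCTriple a b c →
    (a * b * c).primeFactors.card ≤ W → (c : ℝ) < C * ((rad a b c : ℕ) : ℝ) ^ A

/-- LOW: abc(1+ε) on the bounded-ω triples of polynomially bounded quality — for every `W`, `A`, `C'`:
triples with `ω(abc) ≤ W` and `c < C'·rad^A` satisfy `c < C·rad^(1+ε)`. [folklore] -/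
def LowRegimeBoundedOmega : Prop :=
  ∀ W : ℕ, ∀ A C' : ℝ, ∀ ε : ℝ, 0 < ε → ∃ C : ℝ, 0 < C ∧ ∀ a b c : ℕ, IsABCTriple a b c →
    (a * b * c).primeFactors.card ≤ W → (c : ℝ) < C' * ((rad a b c : ℕ) : ℝ) ^ A →
    (c : ℝ) < C * ((rad a b c : ℕ) : ℝ) ^ (1 + ε)

/-- **Glue of the regime cut**: POLY ∧ LOW ⟹ `BoundedOmegaABC` (take `A(W), C'(W)` from POLY and feed
LOW at that exponent). [folklore] -/
theorem boundedOmega_of_poly_of_low (hP : PolyBoundedOmega) (hL : LowRegimeBoundedOmega) :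
    BoundedOmegaABC := by
  intro W ε hε
  obtain ⟨A, C', hC', hP'⟩ := hP W
  obtain ⟨C, hC, hL'⟩ := hL W A C' ε hε
  exact ⟨C, hC, fun a b c ht hω => hL' a b c ht hω (hP' a b c ht hω)⟩

/-- POLY sits below `BoundedOmegaABC` (exponent `2 = 1 + 1`). [folklore] -/
theorem poly_of_boundedOmega (hB : BoundedOmegaABC) : PolyBoundedOmega := by
  intro W
  obtain ⟨C, hC, hCabc⟩ := hB W 1 one_pos
  exact ⟨1 + 1, C, hC, hCabc⟩

/-- LOW sits below `BoundedOmegaABC` (ignore the regime hypothesis). [folklore] -/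
theorem low_of_boundedOmega (hB : BoundedOmegaABC) : LowRegimeBoundedOmega := by
  intro W A C' ε hε
  obtain ⟨C, hC, hCabc⟩ := hB W ε hε
  exact ⟨C, hC, fun a b c ht hω _ => hCabc a b c ht hω⟩

/-- The cut is lossless: `BoundedOmegaABC ↔ POLY ∧ LOW`. [folklore] -/
theorem boundedOmega_iff_poly_and_low : BoundedOmegaABC ↔ PolyBoundedOmega ∧ LowRegimeBoundedOmega :=
  ⟨fun h => ⟨poly_of_boundedOmega h, low_of_boundedOmega h⟩, fun h => boundedOmega_of_poly_of_low h.1 h.2⟩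

/-- And therefore, modulo #6, a line for the crux through the regime cut would read
POLY → LOW → DeepRegimeABC → `UniformSadicTowerFour` — kernel-composed here to show the cut is
well-typed; deliberately NOT registered (both open pieces are plan-less, census §Decomposition). [folklore] -/
theorem uniformSadicTowerFour_of_poly_of_low_of_deepRegimeABC (hP : PolyBoundedOmega)
    (hL : LowRegimeBoundedOmega) (h₆ : DeepRegimeABC) : UniformSadicTowerFour :=
  uniformSadicTowerFour_of_boundedOmega_of_deepRegimeABC (boundedOmega_of_poly_of_low hP hL) h₆

end Summit.ABC.ABC.Cruxes.UniformSadicTowerFour.StrategistS1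

end
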